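import Mathlib.Order.Filter.AtTopBot.Basic
import Literature.Analysis.FluidPDE.PassiveScalar
import Literature.Analysis.FluidPDE.Onsager
import Literature.Analysis.FluidPDE.EulerReynolds
import Literature.Analysis.FunctionSpaces.HolderNorm
import Literature.Analysis.FunctionSpaces.TorusSobolevNorm
import Literature.Analysis.FunctionSpaces.Complexify
import HarnessLib

/-!
# Anomalous dissipation of scalars advected by Hölder weak Euler flows (Burczak–Székelyhidi–Wu 2023)

Topic `Literature/Analysis/FluidPDE`. One Lean file for §1 and §3 of

* J. Burczak, L. Székelyhidi Jr., B. Wu, *Anomalous dissipation and Euler flows*, arXiv:2310.02934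
  (v2, 18 Sep 2024; 66 pp.), Thm. 1.1 (p. 2, (1.4)), §1.1 "Strong density" / "Weak density" (p. 2),
  §2.2 (2.27) (p. 11: the diffusivities `κ_q = λ_q^{-θ}`), §2.3 (p. 17, (2.65): smooth strict
  subsolutions and their energy), Thm. 3.1 (pp. 18–19, (3.1)–(3.4)), the proofs of Thm. 1.1 and of
  the density statements (p. 19), §3.1 Step 7 (p. 23, (3.27)–(3.28)). Bib key
  `BurczakSzekelyhidiWu2023`.

The paper combines the convex-integration scheme of Buckmaster–De Lellis–Székelyhidi–Vicol (the
tree's `onsager_flexibility`, `Literature/Analysis/FluidPDE/Onsager.lean`) with the iterated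
quantitative homogenisation of Armstrong–Vicol (the tree's `armstrong_vicol`,
`Literature/Analysis/FluidPDE/TurbPassiveScalar.lean`): the drift exhibiting anomalous dissipation
of every `H¹` passive scalar is itself a weak solution of the (unforced, deterministic)
incompressible Euler equations on `T³`, of class `C^β`, `β < 1/3`.

## Contents (statement-first, D-0014/D-0064: the results are NAMED FACTS `def … : Prop`, no proofs)

* `Torus.HasScalarAnomalousDissipationAlong T₀ u κ` (definition): "the advection–diffusion equation
  with velocity `u` exhibits anomalous dissipation on `[0,T₀]` along the diffusivities `κ_q → 0`, for
  all mean-zero `H¹` data and all `T ∈ (0,T₀]`" — the common conclusion (1.4) = (3.3) of Thm. 1.1 /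
  Thm. 3.1 in the eventually-in-`q` form of its proof (§3.1 Step 7, (3.28): for every `q ≥ q_I`,
  `q_I = q_I(ℓ_in, T)`), the design of `armstrong_vicol` and of
  `Barriers.AnomalousDissipation.BurczakSzekelyhidiWu2026_thm11`.
* `Torus.IsSmoothStrictEulerSubsolutionOn S u p R` (definition; §2.3 p. 17): smooth strict
  subsolutions of Euler (Daneri–Székelyhidi 2017) — the Euler–Reynolds system
  `∂ₜu + div (u ⊗ u) + ∇p = div R`, `div u = 0`, `⨍ u = 0`, `⨍ p = 0`, with `R` symmetric and
  uniformly positive definite; `Torus.subsolutionEnergy u R t = ∫ (|u|² + tr R)` ((2.65)).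
* `BurczakSzekelyhidiWu2023_thm11` — Thm. 1.1 (p. 2).
* `BurczakSzekelyhidiWu2023_thm31` — Thm. 3.1 (pp. 18–19) without the potential estimate (3.2)
  (see "Rendering").
* `BurczakSzekelyhidiWu2023_strongDensity`, `BurczakSzekelyhidiWu2023_weakDensity` — the two
  `h`-principle statements of §1.1 (p. 2), proved on p. 19 from Thm. 3.1.
* `BurczakSzekelyhidiWu2023_richardsonBound` — §1.2 (1.5) (p. 2): the explicit lower bound
  `c₀ ≥ c_ε min{ℓ₀^{-2p_ε} ℓ_in^{2p_ε−2} T^{p_ε}, ℓ_in^{2ε}}`, `p_ε → 2/(1−β)` (Richardson scaling),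
  uniform over the data (appended 2026-08-26, same source section).

## Rendering (every deviation from print is a WEAKENING, listed here)

* `limsup_{κ→0} κ ∫₀ᵀ ‖∇ρ_κ‖² ≥ c₀ ‖ρ_in‖²` ((1.4), (3.3)) is recorded, as for `armstrong_vicol` and
  `BurczakSzekelyhidiWu2026_thm11`, in the form its proof gives (§3.1 Step 7, p. 23: (3.28) holds
  "for any `q ≥ q_I`" along `κ_q = λ_q^{-θ}` of (2.27), a sequence fixed in Step 1 of the proof
  before the datum is chosen, with `q_I = q_I(ℓ_in, T)` from (3.10)): ONE sequence `κ_q > 0`,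
  `κ_q → 0` for all data, and for each datum and each `T ∈ (0,T₀]` a constant `c > 0` and the bound
  for all sufficiently large `q`; this implies the printed `limsup` form. The dependence
  "`c₀` depends only on `β`, `ℓ_in = ‖ρ_in‖/‖∇ρ_in‖` and `T`" and the explicit lower bound (3.4) /
  (1.5) are not transcribed (the constant is existential, per datum and per `T`).
* "the family of unique solutions `{ρ_κ}`": the statements quantify over ALL weak solutions
  `θ ∈ L^∞_t L²_x` of the advection–diffusion equation on `T³ × [0,T₀)` with datum `ρ_in`
  (`Torus.IsWeakScalarTransportOn T₀ κ u ρ_in θ`); for the bounded (indeed `C^β`) divergence-free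
  drifts in question and `κ > 0` the weak solution exists and is unique (energy argument; the same
  design and the same remark as in the docstring of `armstrong_vicol`), so this renders "the"
  solution, and the spectral dissipation `Torus.eScalarDissipation` does not see null modifications.
* `u ∈ C^β(T³ × [0,T₀])` is `HolderOnSpaceTime β T₀ u` (the BDSV form used by
  `onsager_flexibility`); "weak solution of Euler" is `IsWeakEulerSolution T₀ u`
  (pressure-free distributional form on `T³ × (0,T₀)`, De Lellis–Székelyhidi).
* Thm. 3.1: the closeness estimates are NOT transcribed — (3.1) `‖ū − u‖_{C⁰} ≤ C̄ ‖R̄‖^{1/2}_{C⁰}`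
  with "`C̄` depending only on `ū` and on `inf min{R̄ζ·ζ : |ζ|=1}/tr R̄`" (its content is the
  uniformity of `C̄` over the subsolutions, which is exactly what the strong-density statement of
  §1.1 consumes, and that statement is vendored as printed), and (3.2) `‖z̄ − z‖_{C⁰} ≤ ε` on the
  Biot–Savart potentials (no vector potential on `T³` in the tree; its printed consequence, the
  weak-density statement of §1.1 in `C([0,T]; H⁻¹(T³))`, is vendored instead, with the tree's
  spectral `H⁻¹` norm `Torus.eSobolevNorm (-1)` of the complexified difference as in
  `Torus.ChoffrutSzekelyhidi2014_thm1`); the parameter `b` and `δ₀` of (3.4) are internal to the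
  omitted quantitative bound. What remains of Thm. 3.1 beyond Thm. 1.1 is the prescribed kinetic
  energy "`∫_{T³} |u(x,t)|² dx = e(t)` for all `t`", `e` the energy (2.65) of an ARBITRARY smooth
  strict subsolution, rendered with `energyProfile u t = ½ ∫ ‖u t‖²` (`Onsager.lean`) as
  `energyProfile u t = e t / 2` on `[0,T₀]`; the derivation of Thm. 1.1 from it with the trivial
  subsolution `(0, 0, ⅓ Id)` of p. 19 (and `strongDensity → thm11`) is proved in the companion file
  `EulerFlowsScalarAnomalousDissipationProofs.lean` (this file is statement-only).
* Density statements: "there is a sequence `u^{(n)}` … with `‖u^{(n)} − ū‖ → 0`" is rendered as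
  "for every `ε > 0` there is `u` … with distance `≤ ε`" (equivalent). The smooth fields `ū` are
  taken with zero spatial mean at every time (the paper's standing normalisation (2.2)/(2.65),
  "recalling that we assume zero spatial average of `u`", p. 9), smooth on the closed slab
  `[0,T₀] × T³` (`IsSmoothSpaceTimeOn (Icc 0 T₀)`); a smooth Euler solution is a classical
  solution `Torus.IsClassicalNSSolutionOn (Icc 0 T₀) 0 0 ū p̄` (viscosity `0`, no force).
* `T³` only, `H¹` data, as printed. Nothing here is proved (convex integration + iterated
  homogenisation, 66 pp.); no new notation, no instances.

## References

* J. Burczak, L. Székelyhidi Jr., B. Wu, arXiv:2310.02934v2 (2024), locators above.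
  [`BurczakSzekelyhidiWu2023`]
* S. Daneri, L. Székelyhidi Jr., Arch. Ration. Mech. Anal. 224 (2017) 471–514, §3 (strict
  subsolutions, Prop. 3.1). [`DaneriSzekelyhidi2017`]
* T. Buckmaster, C. De Lellis, L. Székelyhidi Jr., V. Vicol, CPAM 72 (2019), Thm. 1.1, §2.1.
  [`BuckmasterEtAl2018`]
* S. Armstrong, V. Vicol, Ann. PDE 11 (2025) = arXiv:2305.05048v3, Thm. 1.1. [`ArmstrongVicol2025`]
-/

open MeasureTheory Set Filter Topology
open scoped InnerProductSpace ENNReal NNReal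

noncomputable section

namespace Literature.Analysis.FluidPDE

namespace Torus

/-! ## The common conclusion: anomalous dissipation along a sequence of diffusivities -/

/-- **Scalar anomalous dissipation along a sequence of diffusivities** (the conclusion (1.4) =
(3.3) of Burczak–Székelyhidi–Wu, Thm. 1.1 / Thm. 3.1, in the form proved in §3.1 Step 7, (3.28)).
For a drift `u : ℝ × T³ → ℝ³`, a horizon `T₀` and diffusivities `κ : ℕ → ℝ`: every `κ_q` is
positive, `κ_q → 0`, and for every non-zero mean-zero datum `θ₀ ∈ H¹(T³)` and every `T ∈ (0,T₀]`
there is a constant `c > 0` such that, for all sufficiently large `q`, every weak solution `θ` of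
`∂ₜθ + u·∇θ = κ_q Δθ`, `θ(0) = θ₀` on `T³ × [0,T₀)` satisfies
`c ‖θ₀‖²_{L²} ≤ κ_q ∫₀ᵀ ‖∇θ(t)‖²_{L²} dt` (`Torus.scalarL2Sq`, spectral `Torus.eScalarDissipation`;
`H¹` membership via `Torus.MemSobolev 1` of the complexified scalar, as in `armstrong_vicol`).
[cite: BurczakSzekelyhidiWu2023, Thm. 1.1 (1.4) p. 2; §3.1 Step 7 (3.28) p. 23] -/
def HasScalarAnomalousDissipationAlong (T₀ : ℝ)
    (u : ℝ → UnitAddTorus (Fin 3) → EuclideanSpace ℝ (Fin 3)) (κ : ℕ → ℝ) : Prop :=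
  (∀ q, 0 < κ q) ∧ Tendsto κ atTop (𝓝 0) ∧
    ∀ θ₀ : UnitAddTorus (Fin 3) → ℝ,
      FunctionSpaces.Torus.MemSobolev 1 (fun x => (θ₀ x : ℂ)) →
      FunctionSpaces.Torus.HasZeroMean θ₀ → 0 < scalarL2Sq θ₀ →
      ∀ T : ℝ, 0 < T → T ≤ T₀ →
        ∃ c : ℝ, 0 < c ∧ ∀ᶠ q in atTop, ∀ θ : ℝ → UnitAddTorus (Fin 3) → ℝ,
          IsWeakScalarTransportOn T₀ (κ q) u θ₀ θ →
            ENNReal.ofReal (c * scalarL2Sq θ₀) ≤ eScalarDissipation (κ q) θ 0 T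

/-! ## Smooth strict subsolutions of Euler (§2.3) -/

variable {d : Type*} [Fintype d] [DecidableEq d]

/-- **Smooth strict subsolutions of the Euler equations** on `T^d × S` (Burczak–Székelyhidi–Wu
§2.3, p. 17: "a smooth triple `(ū, p̄, R̄)` on `T³ × [0,T]` solving the Euler–Reynolds system (2.1)
with the normalizations `⨍ ū dx = 0`, `⨍ p̄ dx = 0`, such that `R̄(x,t)` is uniformly positive
definite on `T³ × [0,T]`"; Daneri–Székelyhidi 2017, §3). The Euler–Reynolds system (2.1) is
`∂ₜu + div (u ⊗ u) + ∇p = div R`, `div u = 0`; for divergence-free smooth `u`,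
`div (u ⊗ u) = (u·∇)u = Torus.convect (u t) (u t)` (as in `Torus.IsEulerReynoldsOn`, whose
trace-free constraint `tr R̊ = 0` is what distinguishes the Reynolds DEFECT of (2.2) from the
positive definite stress of a subsolution). The stress is a `2`-tensor field stored by columns
(`R t x j ∈ ℝ^d` the `j`-th column, `Torus.tensorDivergence`), symmetric; uniform positive
definiteness: `∑ⱼ ξⱼ ⟪R t x j, ξ⟫ = ξᵀ R ξ ≥ λ |ξ|²` for one `λ > 0` and all `(t, x, ξ)`. Time
derivative: the one-sided `Torus.timeDerivWithin S` (convention of `Torus.IsClassicalNSSolutionOn`).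
[cite: BurczakSzekelyhidiWu2023, §2.3 p. 17; DaneriSzekelyhidi2017, §3] -/
structure IsSmoothStrictEulerSubsolutionOn (S : Set ℝ) (u : ℝ → UnitAddTorus d → EuclideanSpace ℝ d)
    (p : ℝ → UnitAddTorus d → ℝ) (R : ℝ → UnitAddTorus d → d → EuclideanSpace ℝ d) : Prop where
  /-- The velocity is jointly smooth on `S × T^d`. -/
  smooth_velocity : FunctionSpaces.Torus.IsSmoothSpaceTimeOn S u
  /-- The pressure is jointly smooth on `S × T^d`. -/
  smooth_pressure : FunctionSpaces.Torus.IsSmoothSpaceTimeOn S p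
  /-- The stress is jointly smooth on `S × T^d`. -/
  smooth_stress : FunctionSpaces.Torus.IsSmoothSpaceTimeOn S R
  /-- The Euler–Reynolds momentum equation `∂ₜu + (u·∇)u + ∇p = div R` on `S × T^d`. -/
  momentum : ∀ t ∈ S, ∀ x,
    FunctionSpaces.Torus.timeDerivWithin S u t x + FunctionSpaces.Torus.convect (u t) (u t) x +
        FunctionSpaces.Torus.gradient (p t) x = tensorDivergence (R t) x
  /-- Incompressibility `div u(t) = 0`. -/
  divFree : ∀ t ∈ S, FunctionSpaces.Torus.IsDivFree (u t)
  /-- Normalisation `⨍ u(t) = 0`. -/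
  hasZeroMean_velocity : ∀ t ∈ S, FunctionSpaces.Torus.HasZeroMean (u t)
  /-- Normalisation `⨍ p(t) = 0`. -/
  hasZeroMean_pressure : ∀ t ∈ S, FunctionSpaces.Torus.HasZeroMean (p t)
  /-- The stress is symmetric, `R_{ij} = R_{ji}`. -/
  symm : ∀ t ∈ S, ∀ x, ∀ i j : d, R t x i j = R t x j i
  /-- The stress is uniformly positive definite on `S × T^d`: `ξᵀ R(t,x) ξ ≥ λ |ξ|²`. -/
  uniformlyPosDef : ∃ lam : ℝ, 0 < lam ∧ ∀ t ∈ S, ∀ x, ∀ ξ : EuclideanSpace ℝ d,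
    lam * ‖ξ‖ ^ 2 ≤ ∑ j, ξ j * ⟪R t x j, ξ⟫_ℝ

/-- **The energy of a subsolution** ((2.65), p. 17; Daneri–Székelyhidi 2017):
`e(t) = ⨍_{T^d} (|ū|² + tr R̄) dx` (`volume` on `T^d` is a probability measure, so `⨍ = ∫`; the
trace of the column-stored stress is `∑ᵢ R t x i i`). [cite: BurczakSzekelyhidiWu2023, §2.3 (2.65) p. 17] -/
def subsolutionEnergy (u : ℝ → UnitAddTorus d → EuclideanSpace ℝ d)
    (R : ℝ → UnitAddTorus d → d → EuclideanSpace ℝ d) (t : ℝ) : ℝ :=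
  ∫ x, (‖u t x‖ ^ 2 + ∑ i, R t x i i)

omit [DecidableEq d] in
/-- Unfolding lemma for `subsolutionEnergy` ((2.65)). [cite: BurczakSzekelyhidiWu2023, §2.3 (2.65) p. 17] -/
theorem subsolutionEnergy_def (u : ℝ → UnitAddTorus d → EuclideanSpace ℝ d)
    (R : ℝ → UnitAddTorus d → d → EuclideanSpace ℝ d) (t : ℝ) :
    subsolutionEnergy u R t = ∫ x, (‖u t x‖ ^ 2 + ∑ i, R t x i i) := rfl

end Torus

/-! ## The named facts -/

/-- **Burczak–Székelyhidi–Wu 2023, Theorem 1.1** (arXiv:2310.02934v2, p. 2). "Let `0 < T₀ < ∞`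
and `0 < β < 1/3`. There exists a weak solution `u ∈ C^β(T³ × [0,T₀])` to [incompressible Euler]
such that, for every non-zero initial datum `ρ_in ∈ H¹(T³)` with zero mean, the family of unique
solutions `{ρ_κ}_{κ>0}` to [`∂ₜρ + u·∇ρ − κΔρ = 0`, `ρ|_{t=0} = ρ_in`] satisfies for any `T ≤ T₀`
`limsup_{κ→0} κ ∫₀ᵀ ‖∇ρ_κ‖²_{L²} dt ≥ c₀ ‖ρ_in‖²_{L²}` (1.4), where `c₀ > 0` depends only on `β`,
`‖ρ_in‖_{L²}/‖∇ρ_in‖_{L²}` and `T`." Rendered (module docstring): a weak Euler solution on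
`T³ × (0,T₀)` (`IsWeakEulerSolution`), `β`-Hölder on `[0,T₀] × T³` (`HolderOnSpaceTime`), with
anomalous dissipation of all non-zero mean-zero `H¹` scalars along one sequence `κ_q → 0`
(`Torus.HasScalarAnomalousDissipationAlong`, the eventually-in-`q` form (3.28) of the proof, which
implies (1.4)). [cite: BurczakSzekelyhidiWu2023, Thm. 1.1 p. 2; §3.1 Step 7 (3.28) p. 23] -/
def BurczakSzekelyhidiWu2023_thm11 : Prop :=
  ∀ (T₀ : ℝ) (_hT₀ : 0 < T₀) (β : ℝ≥0) (_hβ : 0 < β ∧ β < 1 / 3),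
    ∃ u : ℝ → UnitAddTorus (Fin 3) → EuclideanSpace ℝ (Fin 3),
      IsWeakEulerSolution T₀ u ∧ FunctionSpaces.HolderOnSpaceTime β T₀ u ∧
      ∃ κ : ℕ → ℝ, Torus.HasScalarAnomalousDissipationAlong T₀ u κ

/-- **Burczak–Székelyhidi–Wu 2023, Theorem 3.1** (arXiv:2310.02934v2, pp. 18–19; the general,
`h`-principle form). "Let `T₀ < ∞`. Let `(ū, p̄, R̄)` be a smooth strict Euler subsolution on
`T³ × [0,T₀]` with smooth, strictly positive energy `e : [0,T₀] → ℝ`. Let `0 < β < 1/3` and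
`1 < b < min{√(3/2), (1−β)/(2β)}`. There exists `C̄`, depending only on `ū` and on
`inf_{(x,t)} min{R̄ζ·ζ : |ζ|=1}/tr R̄` such that, for any `ε > 0`, we have: There exists a weak
solution `u ∈ C^β(T³ × [0,T₀])` to the Euler equations with kinetic energy `∫_{T³}|u(x,t)|² dx = e(t)`
for all `t`, such that `‖ū − u‖_{C⁰} ≤ C̄ ‖R̄‖^{1/2}_{C⁰}` (3.1), `‖z̄ − z‖_{C⁰} ≤ ε` (3.2), where
`z̄, z` are potentials for `ū, u`. Moreover, there exists `δ₀ > 0` … such that for any `T ≤ T₀` and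
for every non-zero initial datum `ρ_in ∈ H¹(T³)` with zero mean, the family of unique solutions
`{ρ_κ}` … satisfies `limsup_{κ→0} κ ∫₀ᵀ ‖∇ρ_κ‖² dt ≥ c₀ ‖ρ_in‖²` (3.3), where `c₀ > 0` satisfies
[(3.4)]." Rendered (module docstring "Rendering"): for every smooth strict subsolution
(`Torus.IsSmoothStrictEulerSubsolutionOn (Icc 0 T₀)`, energy `e = Torus.subsolutionEnergy ū R̄`,
assumed positive on `[0,T₀]`) and every `0 < β < 1/3` there is a weak Euler solution `u` of class
`C^β([0,T₀] × T³)` with `½ ∫ ‖u(t)‖² = e(t)/2` on `[0,T₀]` and anomalous dissipation of all non-zero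
mean-zero `H¹` scalars along one sequence `κ_q → 0`. NOT transcribed (weakening): the closeness
estimates (3.1) `‖ū − u‖_{C⁰} ≤ C̄ ‖R̄‖^{1/2}_{C⁰}` (whose content is the uniformity of `C̄`, vendored
as printed in `BurczakSzekelyhidiWu2023_strongDensity`) and (3.2) `‖z̄ − z‖_{C⁰} ≤ ε` on the
Biot–Savart potentials (vendored through its printed consequence
`BurczakSzekelyhidiWu2023_weakDensity`), the parameter `b` and the quantitative bound (3.4).
[cite: BurczakSzekelyhidiWu2023, Thm. 3.1 pp. 18–19; §2.3 (2.65) p. 17; §3.1 Step 7 (3.28) p. 23] -/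
def BurczakSzekelyhidiWu2023_thm31 : Prop :=
  ∀ (T₀ : ℝ) (_hT₀ : 0 < T₀)
    (ubar : ℝ → UnitAddTorus (Fin 3) → EuclideanSpace ℝ (Fin 3)) (pbar : ℝ → UnitAddTorus (Fin 3) → ℝ)
    (Rbar : ℝ → UnitAddTorus (Fin 3) → Fin 3 → EuclideanSpace ℝ (Fin 3))
    (_hsub : Torus.IsSmoothStrictEulerSubsolutionOn (Icc 0 T₀) ubar pbar Rbar)
    (_he : ∀ t ∈ Icc 0 T₀, 0 < Torus.subsolutionEnergy ubar Rbar t)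
    (β : ℝ≥0) (_hβ : 0 < β ∧ β < 1 / 3),
    ∃ u : ℝ → UnitAddTorus (Fin 3) → EuclideanSpace ℝ (Fin 3),
      IsWeakEulerSolution T₀ u ∧ FunctionSpaces.HolderOnSpaceTime β T₀ u ∧
      (∀ t ∈ Icc 0 T₀, energyProfile u t = Torus.subsolutionEnergy ubar Rbar t / 2) ∧
      ∃ κ : ℕ → ℝ, Torus.HasScalarAnomalousDissipationAlong T₀ u κ

/-- **Burczak–Székelyhidi–Wu 2023, §1.1 "Strong density"** (arXiv:2310.02934v2, p. 2; proved on
p. 19 from Thm. 3.1 with the subsolutions `(ū, p̄, (1/n) Id)`). "For any smooth Euler solution `ū`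
there is sequence `{u^{(n)}}_{n∈ℕ}` of Euler solutions with properties as in Theorem 1.1, such that
`‖u^{(n)} − ū‖_{C⁰(T³×[0,T])} → 0` … The constant `c₀` in Theorem 1.1 depends in both of cases
above additionally on `n`." Rendered: for every classical (jointly smooth on `[0,T₀] × T³`,
zero-mean — the paper's normalisation) solution `(ū, p̄)` of incompressible Euler
(`Torus.IsClassicalNSSolutionOn (Icc 0 T₀) 0 0 ū p̄`), every `0 < β < 1/3` and every `ε > 0` there
is a weak Euler solution `u ∈ C^β([0,T₀] × T³)` with `|u(t,x) − ū(t,x)| ≤ ε` on `[0,T₀] × T³` and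
anomalous dissipation of all mean-zero `H¹` scalars along a sequence `κ_q → 0` (sequence and
constants depending on `u`, i.e. on `n`). [cite: BurczakSzekelyhidiWu2023, §1.1 p. 2; proof p. 19] -/
def BurczakSzekelyhidiWu2023_strongDensity : Prop :=
  ∀ (T₀ : ℝ) (_hT₀ : 0 < T₀)
    (ubar : ℝ → UnitAddTorus (Fin 3) → EuclideanSpace ℝ (Fin 3)) (pbar : ℝ → UnitAddTorus (Fin 3) → ℝ)
    (_hubar : FunctionSpaces.Torus.IsClassicalNSSolutionOn (Icc 0 T₀) 0 (fun _ _ => 0) ubar pbar)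
    (_hmean : ∀ t ∈ Icc 0 T₀, FunctionSpaces.Torus.HasZeroMean (ubar t))
    (β : ℝ≥0) (_hβ : 0 < β ∧ β < 1 / 3) (ε : ℝ) (_hε : 0 < ε),
    ∃ u : ℝ → UnitAddTorus (Fin 3) → EuclideanSpace ℝ (Fin 3),
      IsWeakEulerSolution T₀ u ∧ FunctionSpaces.HolderOnSpaceTime β T₀ u ∧
      (∀ t ∈ Icc 0 T₀, ∀ x, ‖u t x - ubar t x‖ ≤ ε) ∧
      ∃ κ : ℕ → ℝ, Torus.HasScalarAnomalousDissipationAlong T₀ u κ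

/-- **Burczak–Székelyhidi–Wu 2023, §1.1 "Weak density"** (arXiv:2310.02934v2, p. 2; proved on
p. 19 from Thm. 3.1 (3.2) with the subsolutions `(ū, 0, ẽ(t) Id + ℛ(∂ₜū) + ū ⊗ ū)`). "For any
smooth solenoidal `ū` there is sequence `{u^{(n)}}_{n∈ℕ}` of Euler solutions with properties as in
Theorem 1.1, such that `‖u^{(n)} − ū‖_{C([0,T];H⁻¹(T³))} → 0`." Rendered: for every jointly smooth,
divergence-free, zero-mean (the paper's normalisation) field `ū` on `[0,T₀] × T³`, every
`0 < β < 1/3` and every `ε > 0` there is a weak Euler solution `u ∈ C^β([0,T₀] × T³)` with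
`‖u(t) − ū(t)‖_{H⁻¹(T³)} ≤ ε` for all `t ∈ [0,T₀]` (the tree's inhomogeneous spectral norm
`Torus.eSobolevNorm (-1)` of the complexified difference; the paper's normalisation of `H⁻¹` may
differ by constants, immaterial for an "every `ε`" statement) and anomalous dissipation of all
mean-zero `H¹` scalars along a sequence `κ_q → 0`. [cite: BurczakSzekelyhidiWu2023, §1.1 p. 2; proof p. 19] -/
def BurczakSzekelyhidiWu2023_weakDensity : Prop :=
  ∀ (T₀ : ℝ) (_hT₀ : 0 < T₀)
    (ubar : ℝ → UnitAddTorus (Fin 3) → EuclideanSpace ℝ (Fin 3))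
    (_hsmooth : FunctionSpaces.Torus.IsSmoothSpaceTimeOn (Icc 0 T₀) ubar)
    (_hdiv : ∀ t ∈ Icc 0 T₀, FunctionSpaces.Torus.IsDivFree (ubar t))
    (_hmean : ∀ t ∈ Icc 0 T₀, FunctionSpaces.Torus.HasZeroMean (ubar t))
    (β : ℝ≥0) (_hβ : 0 < β ∧ β < 1 / 3) (ε : ℝ) (_hε : 0 < ε),
    ∃ u : ℝ → UnitAddTorus (Fin 3) → EuclideanSpace ℝ (Fin 3),
      IsWeakEulerSolution T₀ u ∧ FunctionSpaces.HolderOnSpaceTime β T₀ u ∧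
      (∀ t ∈ Icc 0 T₀,
        FunctionSpaces.Torus.eSobolevNorm (-1) (FunctionSpaces.EuclideanSpace.complexify ∘ fun x => u t x - ubar t x) ≤
          ENNReal.ofReal ε) ∧
      ∃ κ : ℕ → ℝ, Torus.HasScalarAnomalousDissipationAlong T₀ u κ

/-! ## §1.2: the explicit (Richardson-type) lower bound (1.5) -/

/-- **Burczak–Székelyhidi–Wu 2023, §1.2, the explicit constant (1.5)** (arXiv:2310.02934v2, p. 2;
derived from (3.4) of Thm. 3.1, pp. 19 and 23–24, §3.1 Step 8). "the constant `c₀` of (1.4) is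
computed explicitly in Theorem 3.1 in terms of the data. In particular, the lower bound (3.4) in
Theorem 3.1 implies the following: for any `0 < β < 1/3` there is `ε_β` such that for any
`0 < ε < ε_β` the statement of Theorem 1.1 holds with constant `c₀` satisfying
`c₀ ≥ c_ε min{ ℓ₀^{-2p_ε} ℓ_in^{2p_ε-2} T^{p_ε}, ℓ_in^{2ε} }` (1.5), where
`p_ε = (2+ε) / (1 − ε(2+ε)/(1+ε) − (1+ε)β)`, `ℓ₀ := sup_{f ∈ Ḣ¹(T³)} ‖f‖_{L²}/‖∇f‖_{L²}`, and
`ℓ_in := ‖ρ_in‖_{L²}/‖∇ρ_in‖_{L²}`. Observe that `p_ε → 2/(1−β)` as `ε → 0`, leading to the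
asymptotic rate `T^{2/(1−β)}` in (1.5). This is in agreement with the Richardson hypothesis on pair
dispersion in turbulence." Rendered: for `T₀ > 0` and `0 < β < 1/3` there is `ε_β > 0` such that for
every `ε ∈ (0, ε_β)` there are a weak Euler solution `u ∈ C^β([0,T₀] × T³)`, ONE sequence
`κ_q > 0`, `κ_q → 0` and ONE constant `c > 0` (print: `c_ε`; here existential after `u`, and the
universal Poincaré factor `ℓ₀^{-2p_ε}` of `T³` is absorbed into it) such that for every non-zero
mean-zero `θ₀ ∈ H¹(T³)` with length scale `ℓ` (`‖θ₀‖²_{L²} = ℓ² ‖∇θ₀‖²_{L²}`, spectral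
`Torus.eScalarGradNormSq`, an identity in `ℝ≥0∞`) and every `T ∈ (0,T₀]`, for all sufficiently
large `q` (threshold depending on `ℓ`, `T`: §3.1 Steps 3 and 8) every weak solution `θ` of the
`κ_q`-problem with datum `θ₀` on `[0,T₀)` has
`c · min{ℓ^{2p_ε−2} T^{p_ε}, ℓ^{2ε}} · ‖θ₀‖²_{L²} ≤ κ_q ∫₀ᵀ ‖∇θ‖²_{L²}` (real powers `Real.rpow`).
The dependence of `u` on `ε` (through the parameter `b` of Thm. 3.1) is as printed ("the statement
of Theorem 1.1 holds with constant …" for each `ε`). [cite: BurczakSzekelyhidiWu2023, §1.2 (1.5) p. 2; Thm. 3.1 (3.4) p. 19; §3.1 Step 8 pp. 23–24] -/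
def BurczakSzekelyhidiWu2023_richardsonBound : Prop :=
  ∀ (T₀ : ℝ) (_hT₀ : 0 < T₀) (β : ℝ≥0) (_hβ : 0 < β ∧ β < 1 / 3),
    ∃ εβ : ℝ, 0 < εβ ∧ ∀ ε : ℝ, 0 < ε → ε < εβ →
      ∃ u : ℝ → UnitAddTorus (Fin 3) → EuclideanSpace ℝ (Fin 3),
        IsWeakEulerSolution T₀ u ∧ FunctionSpaces.HolderOnSpaceTime β T₀ u ∧
        ∃ κ : ℕ → ℝ, (∀ q, 0 < κ q) ∧ Tendsto κ atTop (𝓝 0) ∧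
          ∃ c : ℝ, 0 < c ∧
            ∀ θ₀ : UnitAddTorus (Fin 3) → ℝ,
              FunctionSpaces.Torus.MemSobolev 1 (fun x => (θ₀ x : ℂ)) →
              FunctionSpaces.Torus.HasZeroMean θ₀ → 0 < Torus.scalarL2Sq θ₀ →
              ∀ ℓ : ℝ, 0 < ℓ →
                ENNReal.ofReal (Torus.scalarL2Sq θ₀) = ENNReal.ofReal (ℓ ^ 2) * Torus.eScalarGradNormSq θ₀ →
                ∀ T : ℝ, 0 < T → T ≤ T₀ →
                  ∀ᶠ q in atTop, ∀ θ : ℝ → UnitAddTorus (Fin 3) → ℝ,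
                    Torus.IsWeakScalarTransportOn T₀ (κ q) u θ₀ θ →
                      ENNReal.ofReal
                          (c * min (ℓ ^ (2 * ((2 + ε) / (1 - ε * (2 + ε) / (1 + ε) - (1 + ε) * (β : ℝ))) - 2) *
                                T ^ ((2 + ε) / (1 - ε * (2 + ε) / (1 + ε) - (1 + ε) * (β : ℝ))))
                              (ℓ ^ (2 * ε)) * Torus.scalarL2Sq θ₀) ≤
                        Torus.eScalarDissipation (κ q) θ 0 T

end Literature.Analysis.FluidPDE

end
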